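import Summits.BirchSwinnertonDyer.Rank1Residual.ManinAdditive.HermitianTwistTrichotomyAtThree
import Summits.BirchSwinnertonDyer.BirchSwinnertonDyer.Theorems.ManinLocalTwoThreeTwistingIsogenyDegreeAtThree
import HarnessLib
import HarnessLib.Audit.Tags

/-!
# E-an-5 `HermitianTwistTrichotomyAtThree` and S-an-7 `SqrtMinusThreeChain` ARE THEOREMS — the `χ₋₃`-orbit
# trichotomy for OPTIMAL curves at `27 ∣ N`, BY NAME, from the an-lens period-lattice index engine
# (cell `bsd-f2-manin`, crux C3 `ManinPrimeToThreeAtNine` stmt-BirchSwinnertonDyer-22968; an's THEOREM TARGETS of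
# `HermitianTwistTrichotomyAtThree.lean` (an g1, MEMO-an §13–§14); C2/C3 LEAD `bsd-line-manin23-p1` gen 8)

Summit `BirchSwinnertonDyer`, route `ManinLocalTwoThree`.  The two g1 rows of the analytic lens were typed before the lens
built its INDEX ENGINE (`TwistOrbitIndexEngine`, g5: `optimal_orbit_index_engine`, `optimal_orbit_trichotomy_full`,
`exists_smul_quadraticTwist_eq_of_mem_iff`, `mulLeft_lattice_eq_of_relIndex_eq_one`) and were never closed by name; with
the engine, the `ℚ`-isogeny bridge of this seat's `optimal_orbit_exists_isogeny_degree_mul`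
(`Theorems/ManinLocalTwoThreeTwistingIsogenyDegreeAtThree.lean`) and `isogeny_degree_eq_sq_of_smul_eq` they are theorems:

* `optimal_orbit_hermitian_trichotomy` (general orbit form, any twisting parameter `s` with `s² = d`, `‖s‖² = a` PRIME):
  for lattice-optimal data `D, D′` at a common level with the two-sided steps `sΛ(f′) ⊆ Λ(f)`, `sΛ(f) ⊆ Λ(f′)` and
  `|aₙ(f′)| = |aₙ(f)|`:
  (a) `W ⊗ d ≅_ℚ W′ ⟺ Λ(f) ⊆ sΛ(f′) ∨ Λ(f′) ⊆ sΛ(f)`; (b) `Λ(f) ⊆ sΛ(f′) ⟹ deg′ = a·deg`, `Λ(f′) ⊆ sΛ(f) ⟹ deg = a·deg′`;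
  (c) NO `ℚ`-isomorphism ⟹ `deg′ = deg` and some `ℚ`-isogeny `W ⊗ d → W′` has degree exactly `a`.
  Dictionary: `Λ(f) ⊆ sΛ(f′) ⟺ m = 1`, `Λ(f′) ⊆ sΛ(f) ⟺ m′ = 1` for the engine's indices `m = [Λ_W : (cs/c′)Λ_{W′}]`,
  `m′ = [Λ_{W′} : (c′s/c)Λ_W]` (`m m′ = a²`, `m·deg′ = a·deg`); an isomorphism makes every isogeny degree a square, and the
  engine's isogeny has degree `m ∈ {1, a, a²}`.
* `sqrtMinusThreeChain_holds : SqrtMinusThreeChain` (S-an-7) — the chain with `√−3 = √3·i`: the tree's `pStar_orbit_steps` at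
  `q = 3` gives it for the quadratic Gauss sum `g`, and `g² = −3 = (√3·i)²` forces `g = ±√3·i` (lattices are symmetric).
* `hermitianTwistTrichotomyAtThree_holds : HermitianTwistTrichotomyAtThree` (E-an-5) — the instance `d = −3`, `a = 3`,
  with the same `±` bookkeeping.

HONEST FRAMING: statements about modular degrees / period lattices / isogenies of OPTIMAL curves on a `χ₋₃`-orbit
(`ModularParametrizationData` are hypotheses; modularity is not constructed).  Nothing here bears on BSD or proves
Manin's conjecture or C3; two typed open obligations of the cell (E-an-5, S-an-7; refuter-1 §R4 SURVIVES, refuter-2: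
(b)/(c) «NOT-IN-PRINT … beyond-print theorem candidate») are retired.  E-an-6 (the orientation law) is NOT touched — it is
equivalent to Manin equality on commuting orbits.

References: [Stevens1989] Lemma (5.4); [Pal2012] Lemma 3.1; [SilvermanAEC2009] Thm. VI.4.1(b); [Edixhoven1991] §4;
cell memos MEMO-an §13–§16, §24–§25.
-/

set_option autoImplicit false
-- `Summit.BirchSwinnertonDyer.BirchSwinnertonDyer` is the mandated summit-side namespace (single-conjunct summit).
set_option linter.dupNamespace false

noncomputable section

open scoped Classical MatrixGroups ModularForm

open CongruenceSubgroup WeierstrassCurve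
  Literature.NumberTheory.EllipticCurves Literature.NumberTheory.EllipticCurves.ModularForms
  Summit.BirchSwinnertonDyer.Rank1Residual.ManinAdditive

namespace Summit.BirchSwinnertonDyer.BirchSwinnertonDyer.Theorems.ManinLocalTwoThree

/-! ### Sign bookkeeping: lattice statements are insensitive to `s ↦ −s` -/

/-- `Λ₁ ⊆ s·Λ₂` is insensitive to the sign of `s`. [folklore] -/
theorem forall_exists_eq_mul_of_eq_or_eq_neg {Λ₁ Λ₂ : AddSubgroup ℂ} {s t : ℂ} (hst : s = t ∨ s = -t)
    (h : ∀ z ∈ Λ₁, ∃ w ∈ Λ₂, z = s * w) : ∀ z ∈ Λ₁, ∃ w ∈ Λ₂, z = t * w := by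
  rcases hst with rfl | rfl
  · exact h
  · intro z hz
    obtain ⟨w, hw, rfl⟩ := h z hz
    exact ⟨-w, neg_mem hw, by ring⟩

/-- `s·Λ₂ ⊆ Λ₁` is insensitive to the sign of `s`. [folklore] -/
theorem forall_mul_mem_of_eq_or_eq_neg {Λ₁ Λ₂ : AddSubgroup ℂ} {s t : ℂ} (hst : s = t ∨ s = -t)
    (h : ∀ w ∈ Λ₂, s * w ∈ Λ₁) : ∀ w ∈ Λ₂, t * w ∈ Λ₁ := by
  rcases hst with rfl | rfl
  · exact h
  · intro w hw
    have := h w hw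
    have e : t * w = -(-t * w) := by ring
    rw [e]
    exact neg_mem this

/-- `(√3·i)² = −3` in `ℂ`. [folklore] -/
theorem sqrt_three_mul_I_sq : ((Real.sqrt 3 : ℂ) * Complex.I) ^ 2 = -3 := by
  rw [mul_pow, Complex.I_sq, ← Complex.ofReal_pow, Real.sq_sqrt (by norm_num : (0 : ℝ) ≤ 3)]
  push_cast
  ring

/-- The quadratic Gauss sum at `3` is `±√3·i`. [folklore] -/
theorem gaussSum_three_eq_or_eq_neg :
    (haveI : Fact (Nat.Prime 3) := ⟨Nat.prime_three⟩
    gaussSum ((quadraticChar (ZMod 3)).ringHomComp (Int.castRingHom ℂ)) (ZMod.stdAddChar (N := 3)) =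
        (Real.sqrt 3 : ℂ) * Complex.I ∨
      gaussSum ((quadraticChar (ZMod 3)).ringHomComp (Int.castRingHom ℂ)) (ZMod.stdAddChar (N := 3)) =
        -((Real.sqrt 3 : ℂ) * Complex.I)) := by
  haveI : Fact (Nat.Prime 3) := ⟨Nat.prime_three⟩
  obtain ⟨-, hG2, -⟩ := gaussSum_pStar_facts Nat.prime_three (by norm_num)
  apply sq_eq_sq_iff_eq_or_eq_neg.mp
  rw [hG2, sqrt_three_mul_I_sq, pStar_three_cast]
  push_cast
  ring

/-! ### The general orbit form -/

/-- **The Hermitian-twist trichotomy from the index engine (general orbit form).**  Same level, `D, D′` lattice-optimal,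
two-sided twist steps with `s² = d`, `‖s‖² = a` prime, `|aₙ(f′)| = |aₙ(f)|`:
(a) `W ⊗ d ≅_ℚ W′ ⟺ Λ(f) ⊆ sΛ(f′) ∨ Λ(f′) ⊆ sΛ(f)`; (b) the two inclusions force `deg′ = a·deg`, resp. `deg = a·deg′`;
(c) no `ℚ`-isomorphism ⟹ `deg′ = deg` and a `ℚ`-isogeny `W ⊗ d → W′` of degree exactly `a`.
[cite: SilvermanAEC2009, Thm. VI.4.1(b)] [cite: Pal2012, Lemma 3.1] [cite: Stevens1989, Lemma (5.4)] -/
theorem optimal_orbit_hermitian_trichotomy {W W' : WeierstrassCurve ℚ} [W.IsElliptic] [W'.IsElliptic]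
    {N N' : ℕ} [NeZero N] [NeZero N'] (hNN : N' = N) (D : ModularParametrizationData W N)
    (D' : ModularParametrizationData W' N') (hD : IsLatticeOptimal D) (hD' : IsLatticeOptimal D')
    {d : ℚ} (hd : d ≠ 0) {s : ℂ} (hs0 : s ≠ 0) (hs : s ^ 2 = (d : ℂ)) {a : ℕ} (hpr : a.Prime)
    (ha : ‖s‖ ^ 2 = a)
    (h1 : ∀ w ∈ periodLattice D'.f, s * w ∈ periodLattice D.f)
    (h2 : ∀ w ∈ periodLattice D.f, s * w ∈ periodLattice D'.f)
    (hcoef : ∀ n : ℕ, ‖cuspCoeff D'.f n‖ = ‖cuspCoeff D.f n‖) :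
    ((∃ u : VariableChange ℚ, u • W.quadraticTwist d = W') ↔
        ((∀ z ∈ periodLattice D.f, ∃ w ∈ periodLattice D'.f, z = s * w) ∨
          (∀ z ∈ periodLattice D'.f, ∃ w ∈ periodLattice D.f, z = s * w))) ∧
    ((∀ z ∈ periodLattice D.f, ∃ w ∈ periodLattice D'.f, z = s * w) →
        D'.modularDegree = a * D.modularDegree) ∧
    ((∀ z ∈ periodLattice D'.f, ∃ w ∈ periodLattice D.f, z = s * w) →
        D.modularDegree = a * D'.modularDegree) ∧
    ((¬ ∃ u : VariableChange ℚ, u • W.quadraticTwist d = W') →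
        D'.modularDegree = D.modularDegree ∧ ∃ φ : Isogeny (W.quadraticTwist d) W', φ.degree = a) := by
  haveI := W.isElliptic_quadraticTwist hd
  have hc0 : (D.c : ℂ) ≠ 0 := D.cast_c_ne_zero
  have hc0' : (D'.c : ℂ) ≠ 0 := D'.cast_c_ne_zero
  have hcq : (D.c : ℚ) ≠ 0 := by exact_mod_cast (Int.cast_ne_zero.mp hc0)
  have hcq' : (D'.c : ℚ) ≠ 0 := by exact_mod_cast (Int.cast_ne_zero.mp hc0')
  have ht : (D.c : ℂ) * s / (D'.c : ℂ) ≠ 0 := div_ne_zero (mul_ne_zero hc0 hs0) hc0'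
  have ht' : (D'.c : ℂ) * s / (D.c : ℂ) ≠ 0 := div_ne_zero (mul_ne_zero hc0' hs0) hc0
  obtain ⟨hmm', hmdeg⟩ := optimal_orbit_index_engine hNN D D' hD hD' ha h1 h2 hcoef ht ht'
  set m : ℕ := (D'.L.mulLeft _ ht).lattice.toAddSubgroup.relIndex D.L.lattice.toAddSubgroup with hm_def
  set m' : ℕ := (D.L.mulLeft _ ht').lattice.toAddSubgroup.relIndex D'.L.lattice.toAddSubgroup with hm'_def
  have ha0 : a ≠ 0 := hpr.ne_zero
  have hdegpos : 0 < D.modularDegree := D.deg_pos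
  have hdegpos' : 0 < D'.modularDegree := D'.deg_pos
  -- the two optimality inclusions of the engine
  have hB : (D'.L.mulLeft _ ht).lattice ≤ D.L.lattice := mulLeft_lattice_le_of_optimal D D' hD' h1 ht
  have hB' : (D.L.mulLeft _ ht').lattice ≤ D'.L.lattice := mulLeft_lattice_le_of_optimal D' D hD h2 ht'
  -- the Néron-type pair of `T = W ⊗ d`
  have hT := isNeronLatticeOf_quadraticTwist_of_sq_eq d D.isNeronLattice hs0 hs
  -- DICTIONARY: `Λ(f) ⊆ sΛ(f′) ⟺ m = 1`, `Λ(f′) ⊆ sΛ(f) ⟺ m′ = 1`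
  have hA : (∀ z ∈ periodLattice D.f, ∃ w ∈ periodLattice D'.f, z = s * w) → m = 1 := by
    intro hP
    rw [hm_def, AddSubgroup.relIndex_eq_one]
    intro z hz
    obtain ⟨w, hw, hzw⟩ := hD z hz
    obtain ⟨w', hw', hww'⟩ := hP w hw
    change z ∈ (D'.L.mulLeft _ ht).lattice
    rw [PeriodPair.mem_mulLeft_lattice]
    have e : ((D.c : ℂ) * s / (D'.c : ℂ))⁻¹ * z = (D'.c : ℂ) * w' := by
      rw [hzw, hww']; field_simp
    rw [e]
    exact D'.smul_periodLattice_le _ hw'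
  have hA' : (∀ z ∈ periodLattice D'.f, ∃ w ∈ periodLattice D.f, z = s * w) → m' = 1 := by
    intro hP
    rw [hm'_def, AddSubgroup.relIndex_eq_one]
    intro z hz
    obtain ⟨w, hw, hzw⟩ := hD' z hz
    obtain ⟨w', hw', hww'⟩ := hP w hw
    change z ∈ (D.L.mulLeft _ ht').lattice
    rw [PeriodPair.mem_mulLeft_lattice]
    have e : ((D'.c : ℂ) * s / (D.c : ℂ))⁻¹ * z = (D.c : ℂ) * w' := by
      rw [hzw, hww']; field_simp
    rw [e]
    exact D.smul_periodLattice_le _ hw'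
  have hBk : m = 1 → ∀ z ∈ periodLattice D.f, ∃ w ∈ periodLattice D'.f, z = s * w := by
    intro hm1 z hz
    have hle : D.L.lattice.toAddSubgroup ≤ (D'.L.mulLeft _ ht).lattice.toAddSubgroup :=
      AddSubgroup.relIndex_eq_one.mp (by rw [← hm_def]; exact hm1)
    have hcz : (D.c : ℂ) * z ∈ D.L.lattice := D.smul_periodLattice_le _ hz
    have h' : ((D.c : ℂ) * s / (D'.c : ℂ))⁻¹ * ((D.c : ℂ) * z) ∈ D'.L.lattice :=
      PeriodPair.mem_mulLeft_lattice.mp (hle hcz)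
    obtain ⟨w', hw', heq⟩ := hD' _ h'
    refine ⟨w', hw', ?_⟩
    rw [inv_mul_eq_iff_eq_mul₀ ht] at heq
    have e : (D.c : ℂ) * z = (D.c : ℂ) * (s * w') := by rw [heq]; field_simp
    exact mul_left_cancel₀ hc0 e
  have hBk' : m' = 1 → ∀ z ∈ periodLattice D'.f, ∃ w ∈ periodLattice D.f, z = s * w := by
    intro hm1 z hz
    have hle : D'.L.lattice.toAddSubgroup ≤ (D.L.mulLeft _ ht').lattice.toAddSubgroup :=
      AddSubgroup.relIndex_eq_one.mp (by rw [← hm'_def]; exact hm1)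
    have hcz : (D'.c : ℂ) * z ∈ D'.L.lattice := D'.smul_periodLattice_le _ hz
    have h' : ((D'.c : ℂ) * s / (D.c : ℂ))⁻¹ * ((D'.c : ℂ) * z) ∈ D.L.lattice :=
      PeriodPair.mem_mulLeft_lattice.mp (hle hcz)
    obtain ⟨w', hw', heq⟩ := hD _ h'
    refine ⟨w', hw', ?_⟩
    rw [inv_mul_eq_iff_eq_mul₀ ht'] at heq
    have e : (D'.c : ℂ) * z = (D'.c : ℂ) * (s * w') := by rw [heq]; field_simp
    exact mul_left_cancel₀ hc0' e
  -- the engine's isogeny `T → W′` of degree `m`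
  obtain ⟨φ, hφ⟩ := optimal_orbit_exists_isogeny_degree_mul hNN D D' hD hD' hd hs0 hs ha h1 h2 hcoef
  have hφm : φ.degree = m := by
    have : φ.degree * D'.modularDegree = m * D'.modularDegree := by rw [hφ, hmdeg]
    exact Nat.eq_of_mul_eq_mul_right hdegpos' this
  -- (b)
  have hb : (∀ z ∈ periodLattice D.f, ∃ w ∈ periodLattice D'.f, z = s * w) →
      D'.modularDegree = a * D.modularDegree := by
    intro hP
    have h := hmdeg
    rw [hA hP, one_mul] at h
    exact h
  have hb' : (∀ z ∈ periodLattice D'.f, ∃ w ∈ periodLattice D.f, z = s * w) →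
      D.modularDegree = a * D'.modularDegree := by
    intro hP
    have hm9 : m = a ^ 2 := by
      have h := hmm'
      rw [hA' hP, mul_one] at h
      exact h
    have h := hmdeg
    rw [hm9, pow_two, mul_assoc] at h
    have h' := Nat.eq_of_mul_eq_mul_left (Nat.pos_of_ne_zero ha0) h
    -- `a * deg′ = deg`
    exact h'.symm
  -- (c)
  have hc : (¬ ∃ u : VariableChange ℚ, u • W.quadraticTwist d = W') →
      D'.modularDegree = D.modularDegree ∧ ∃ φ : Isogeny (W.quadraticTwist d) W', φ.degree = a := by
    intro hno
    have hflip : ∀ u : VariableChange ℚ, u • W.quadraticTwist d ≠ W' := fun u hu ↦ hno ⟨u, hu⟩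
    have hdeg := optimal_flip_modularDegree_eq hNN D D' hD hD' hd hs0 hs hpr ha h1 h2 hcoef hflip
    refine ⟨hdeg, φ, ?_⟩
    have : φ.degree * D'.modularDegree = a * D'.modularDegree := by rw [hφ, hdeg]
    exact Nat.eq_of_mul_eq_mul_right hdegpos' this
  -- (a)
  have haiff : (∃ u : VariableChange ℚ, u • W.quadraticTwist d = W') ↔
      ((∀ z ∈ periodLattice D.f, ∃ w ∈ periodLattice D'.f, z = s * w) ∨
        (∀ z ∈ periodLattice D'.f, ∃ w ∈ periodLattice D.f, z = s * w)) := by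
    constructor
    · rintro ⟨u, hu⟩
      obtain ⟨k, hk⟩ := isogeny_degree_eq_sq_of_smul_eq hT D'.isNeronLattice u hu φ
      -- `m = k²` divides `a²`, `a` prime: `m = 1` or `m = a²` (then `m′ = 1`)
      have hmk : m = k ^ 2 := by rw [← hφm, hk]
      have hmdvd : m ∣ a ^ 2 := Dvd.intro _ hmm'
      obtain ⟨i, hi, hmi⟩ := (Nat.dvd_prime_pow hpr).mp hmdvd
      interval_cases i
      · exact Or.inl (hBk (by simpa using hmi))
      · exfalso
        rw [pow_one] at hmi
        -- `k² = a` with `a` prime is impossible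
        have hka : k ∣ a := by rw [← hmi, hmk, pow_two]; exact Dvd.intro _ rfl
        rcases (Nat.dvd_prime hpr).mp hka with hk1 | hk1
        · rw [hmk, hk1, one_pow] at hmi; exact hpr.one_lt.ne hmi
        · rw [hmk, hk1, pow_two] at hmi
          have : a * a = a * 1 := by rw [mul_one]; exact hmi
          have := Nat.eq_of_mul_eq_mul_left (Nat.pos_of_ne_zero ha0) this
          exact hpr.one_lt.ne' this
      · have hm'1 : m' = 1 := by
          have h := hmm'
          rw [hmi] at h
          have : a ^ 2 * m' = a ^ 2 * 1 := by rw [mul_one]; exact h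
          exact Nat.eq_of_mul_eq_mul_left (by positivity) this
        exact Or.inr (hBk' hm'1)
    · rintro (hP | hP)
      · -- `m = 1`: `Λ_{W′} = (c′/c)·Λ_T` rationally
        have hEq : (D'.L.mulLeft _ ht).lattice = D.L.lattice :=
          mulLeft_lattice_eq_of_relIndex_eq_one ht hB (hA hP)
        have hr : (D'.c : ℚ) / (D.c : ℚ) ≠ 0 := div_ne_zero hcq' hcq
        refine exists_smul_quadraticTwist_eq_of_mem_iff D D' hd hs0 hs hr fun z ↦ ?_
        have e : s * (((((D'.c : ℚ) / (D.c : ℚ) : ℚ)) : ℂ)⁻¹ * z) = ((D.c : ℂ) * s / (D'.c : ℂ)) * z := by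
          push_cast; field_simp
        rw [e, ← hEq]
        exact (PeriodPair.mul_mem_mulLeft_lattice (hc := ht) (L := D'.L) (x := z)).symm
      · -- `m′ = 1`: `Λ_{W′} = (c′d/c)·Λ_T` rationally
        have hEq : (D.L.mulLeft _ ht').lattice = D'.L.lattice :=
          mulLeft_lattice_eq_of_relIndex_eq_one ht' hB' (hA' hP)
        have hr : (D'.c : ℚ) * d / (D.c : ℚ) ≠ 0 := div_ne_zero (mul_ne_zero hcq' hd) hcq
        refine exists_smul_quadraticTwist_eq_of_mem_iff D D' hd hs0 hs hr fun z ↦ ?_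
        have e : s * (((((D'.c : ℚ) * d / (D.c : ℚ) : ℚ)) : ℂ)⁻¹ * z) = ((D'.c : ℂ) * s / (D.c : ℂ))⁻¹ * z := by
          have hsd : (d : ℂ) = s * s := by rw [← hs, pow_two]
          push_cast
          rw [hsd]
          field_simp
        rw [e, ← hEq]
        exact PeriodPair.mem_mulLeft_lattice (hc := ht') (L := D.L) (x := z)
  exact ⟨haiff, hb, hb', hc⟩

/-! ### S-an-7 and E-an-5 by name -/

/-- **S-an-7 `SqrtMinusThreeChain` (PROVED BY NAME).**  For parametrisation data of a `−3`-twist pair at the same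
conductor with `9 ∣ N`: `√−3·Λ(f′) ⊆ Λ(f)` and `√−3·Λ(f) ⊆ Λ(f′)` (`√−3 = √3·i`; the tree's `pStar_orbit_steps` at `q = 3`
give it for the quadratic Gauss sum `g = ±√3·i`).  No optimality needed. [cite: Stevens1989, Lemma (5.4)] -/
theorem sqrtMinusThreeChain_holds : SqrtMinusThreeChain := by
  intro W W' _ _ _ _ _ _ D D' h9 hN hiso
  haveI : Fact (Nat.Prime 3) := ⟨Nat.prime_three⟩
  rw [← pStar_three_cast] at hiso
  obtain ⟨h1, h2, -⟩ := pStar_orbit_steps (q := 3) (by norm_num) D D' h9 hN hiso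
  have hst := gaussSum_three_eq_or_eq_neg
  exact ⟨forall_mul_mem_of_eq_or_eq_neg hst h1, forall_mul_mem_of_eq_or_eq_neg hst h2⟩

/-- **E-an-5 `HermitianTwistTrichotomyAtThree` (PROVED BY NAME).**  `27 ∣ N`, `(W, D)`, `(W′, D′)` lattice-optimal at the same
conductor, `W′ ~ W ⊗ χ₋₃`: (a) `W′ ≅_ℚ W ⊗ χ₋₃` iff `Λ(f) ⊆ √−3Λ(f′)` or `Λ(f′) ⊆ √−3Λ(f)`; (b) `Λ(f) ⊆ √−3Λ(f′) ⇒ deg′ = 3·deg`,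
`Λ(f′) ⊆ √−3Λ(f) ⇒ deg = 3·deg′`; (c) otherwise `deg′ = deg` and some `ℚ`-isogeny `W ⊗ χ₋₃ → W′` has degree `3`.  The
instance `d = −3`, `a = 3` of `optimal_orbit_hermitian_trichotomy` with the `±√3·i` bookkeeping; the hypothesis
`¬ IsIsogenous W W′` of the row is not used. [cite: Stevens1989, Lemma (5.4)] [cite: Pal2012, Lemma 3.1] -/
theorem hermitianTwistTrichotomyAtThree_holds : HermitianTwistTrichotomyAtThree := by
  intro W W' _ _ _ _ _ _ D D' hD hD' h27 hN hiso _hniso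
  haveI : Fact (Nat.Prime 3) := ⟨Nat.prime_three⟩
  have h9 : 3 ^ 2 ∣ W.conductorNorm ℤ := (pow_dvd_pow 3 (by norm_num : 2 ≤ 3)).trans h27
  have hiso' := hiso
  rw [← pStar_three_cast] at hiso'
  obtain ⟨hG0, hG2, hGa⟩ := gaussSum_pStar_facts Nat.prime_three (by norm_num)
  rw [pStar_three_cast] at hG2
  obtain ⟨h1, h2, hcoef⟩ := pStar_orbit_steps (q := 3) (by norm_num) D D' h9 hN hiso'
  have hd : ((-3 : ℤ) : ℚ) ≠ 0 := by norm_num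
  obtain ⟨haiff, hb, hb', hc⟩ :=
    optimal_orbit_hermitian_trichotomy hN D D' hD hD' hd hG0 hG2 Nat.prime_three hGa h1 h2 hcoef
  have hst := gaussSum_three_eq_or_eq_neg
  set g := gaussSum ((quadraticChar (ZMod 3)).ringHomComp (Int.castRingHom ℂ)) (ZMod.stdAddChar (N := 3))
    with hg
  have hts : (Real.sqrt 3 : ℂ) * Complex.I = g ∨ (Real.sqrt 3 : ℂ) * Complex.I = -g := by
    rcases hst with h | h
    · exact Or.inl h.symm
    · exact Or.inr (by rw [h, neg_neg])
  refine ⟨?_, ?_, ?_, ?_⟩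
  · rw [haiff]
    constructor
    · rintro (hP | hP)
      · exact Or.inl (forall_exists_eq_mul_of_eq_or_eq_neg hst hP)
      · exact Or.inr (forall_exists_eq_mul_of_eq_or_eq_neg hst hP)
    · rintro (hP | hP)
      · exact Or.inl (forall_exists_eq_mul_of_eq_or_eq_neg hts hP)
      · exact Or.inr (forall_exists_eq_mul_of_eq_or_eq_neg hts hP)
  · exact fun hP ↦ hb (forall_exists_eq_mul_of_eq_or_eq_neg hts hP)
  · exact fun hP ↦ hb' (forall_exists_eq_mul_of_eq_or_eq_neg hts hP)
  · exact hc

end Summit.BirchSwinnertonDyer.BirchSwinnertonDyer.Theorems.ManinLocalTwoThree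

end
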